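import Mathlib.NumberTheory.Padics.MahlerBasis
import Mathlib.Analysis.SpecificLimits.Normed
import Mathlib.Tactic
import HarnessLib

/-!
# `ℤ_p`-powers of one-units in a complete ultrametric `ℤ_p`-algebra: `u^α = Σ C(α, n) (u − 1)ⁿ` (Gouvêa §5.9)

Topic `NumberTheory/LocalFields`; namespace `Literature.NumberTheory.LocalFields.UltrametricAlgebra`. Everything here is proved (theorems only;
no definitions, no named facts, no instances). Companion of `PadicOneUnitsBinomialPowers.lean`, which treats `(1 + x)^α` for `x ∈ ℤ_p`
(and the structure of `1 + pℤ_p`, Serre II §3.2); this file records the binomial-series calculus of ONE-UNITS `u` (`‖u − 1‖ < 1`) of an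
arbitrary complete ultrametric normed commutative ring `A` carrying a bounded `ℤ_p`-module structure (e.g. the valuation ring `𝒪` of a
finite extension of `ℚ_p`, or the field itself) — the setting of Gouvêa's remark that the binomial series makes the one-units
`U¹ = {u : ‖u − 1‖ < 1}` a `ℤ_p`-MODULE (F. Q. Gouvêa, *p-adic Numbers*, §5.9 "The Binomial Series": Lemma 5.9.1 `C(α, n) ∈ ℤ_p`,
Cor. 5.9.2 convergence for `|x| < 1`, and the definition `(1 + x)^α := B(α, x)`; N. Koblitz, *p-adic Numbers, p-adic Analysis, and
Zeta-Functions*, Ch. IV §1). We write `u^α` for `PadicInt.mahlerSeries (fun i ↦ (u - 1) ^ i) α` (Mathlib's Mahler series with coefficients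
`(u − 1)ⁿ → 0`; Lemma 5.9.1 is Mathlib's `BinomialRing ℤ_[p]`) and prove, for `‖u − 1‖ < 1`:

* §1 `oneUnitPow_natCast` — `u^k = uᵏ` for `k ∈ ℕ`; `oneUnitPow_zero/one`, `oneUnitPow_base_one` (`1^α = 1`), `continuous_oneUnitPow`;
* §2 the laws (continuity in the exponent + density of `ℕ ⊆ ℤ_p`): `oneUnitPow_add` — `u^{α+β} = u^α u^β`; `oneUnitPow_neg_mul`,
  `isUnit_oneUnitPow`, `oneUnitPow_intCast`, `oneUnitPow_pow`; ★ `oneUnitPow_mul_base` — `u^α v^α = (uv)^α`;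
* §3 (`‖1‖ = 1`) `norm_oneUnitPow_sub_one_le` — `‖u^α − 1‖ ≤ ‖u − 1‖` (one-units are preserved), `norm_oneUnitPow_le_one`, and
  ★ `oneUnitPow_mul_exp` — `(u^α)^β = u^{αβ}`.

Together: `α • u := u^α` satisfies the axioms of a `ℤ_p`-module structure on the multiplicative group of one-units of `A` extending
`ℤ`-powers — recorded as theorems; packaging it as a `Module` instance is left to consumers.

## References

* F. Q. Gouvêa, *p-adic Numbers: An Introduction*, Universitext, Springer 1993, §5.9 Lemma 5.9.1, Cor. 5.9.2 and the definition of
  `(1 + x)^α` (held text pp. 131–132). [Gouvea1993PadicNumbers]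
* N. Koblitz, *p-adic Numbers, p-adic Analysis, and Zeta-Functions*, GTM 58, 2nd ed. 1984, Ch. IV §1. [Koblitz1984]
* J.-P. Serre, *A Course in Arithmetic*, GTM 7, Springer 1973, Ch. II §3.2 Prop. 8. [Serre1973]
-/

noncomputable section

open Filter Topology Finset

namespace Literature.NumberTheory.LocalFields.UltrametricAlgebra

variable {p : ℕ} [hp : Fact p.Prime]
variable {A : Type*} [NormedCommRing A] [CompleteSpace A] [IsUltrametricDist A]
  [Module ℤ_[p] A] [IsBoundedSMul ℤ_[p] A]

/-! ## §1. The binomial power `u^α = Σ C(α, n) (u − 1)ⁿ` of a one-unit -/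

section Binomial

variable {u v : A}

omit [CompleteSpace A] [IsUltrametricDist A] [Module ℤ_[p] A] [IsBoundedSMul ℤ_[p] A] in
/-- Cor. 5.9.2's hypothesis: for `‖u − 1‖ < 1` the general term `(u − 1)ⁿ` tends to `0`. [cite: Gouvea1993PadicNumbers, §5.9 Cor. 5.9.2] -/
theorem tendsto_sub_one_pow (hu : ‖u - 1‖ < 1) : Tendsto (fun i => (u - 1) ^ i) atTop (𝓝 0) :=
  tendsto_pow_atTop_nhds_zero_of_norm_lt_one hu

/-- `u^α = Σ_n C(α, n) • (u − 1)ⁿ` (the defining series, convergent for `‖u − 1‖ < 1`). [cite: Gouvea1993PadicNumbers, §5.9 Cor. 5.9.2] -/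
theorem oneUnitPow_eq_tsum (hu : ‖u - 1‖ < 1) (α : ℤ_[p]) :
    PadicInt.mahlerSeries (fun i => (u - 1) ^ i) α = ∑' n, Ring.choose α n • (u - 1) ^ n := by
  rw [PadicInt.mahlerSeries_apply (tendsto_sub_one_pow hu)]
  simp [mahler_apply]

/-- For a natural number `α = k`: `u^k = uᵏ` (the binomial theorem). [cite: Gouvea1993PadicNumbers, §5.9] -/
theorem oneUnitPow_natCast (hu : ‖u - 1‖ < 1) (k : ℕ) :
    PadicInt.mahlerSeries (fun i => (u - 1) ^ i) (k : ℤ_[p]) = u ^ k := by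
  rw [PadicInt.mahlerSeries_apply_nat (tendsto_sub_one_pow hu) le_rfl]
  conv_rhs => rw [show u = (u - 1) + 1 by abel, (Commute.one_right (u - 1)).add_pow]
  refine Finset.sum_congr rfl fun i _ => ?_
  rw [one_pow, mul_one, nsmul_eq_mul, mul_comm]

/-- `u^0 = 1`. [cite: Gouvea1993PadicNumbers, §5.9] -/
theorem oneUnitPow_zero (hu : ‖u - 1‖ < 1) : PadicInt.mahlerSeries (fun i => (u - 1) ^ i) (0 : ℤ_[p]) = 1 := by
  simpa using oneUnitPow_natCast hu 0

/-- `u^1 = u`. [cite: Gouvea1993PadicNumbers, §5.9] -/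
theorem oneUnitPow_one (hu : ‖u - 1‖ < 1) : PadicInt.mahlerSeries (fun i => (u - 1) ^ i) (1 : ℤ_[p]) = u := by
  simpa using oneUnitPow_natCast hu 1

omit [CompleteSpace A] [IsUltrametricDist A] in
/-- `‖1 − 1‖ < 1`: the unit `1` is a one-unit. [cite: Gouvea1993PadicNumbers, §5.9] -/
theorem norm_one_sub_one_lt_one : ‖(1 : A) - 1‖ < 1 := by rw [sub_self, norm_zero]; exact one_pos

/-- `1^α = 1`. [cite: Gouvea1993PadicNumbers, §5.9] -/
theorem oneUnitPow_base_one (α : ℤ_[p]) : PadicInt.mahlerSeries (fun i => ((1 : A) - 1) ^ i) α = 1 := by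
  refine PadicInt.denseRange_natCast.induction_on (p := fun a => PadicInt.mahlerSeries (fun i => ((1 : A) - 1) ^ i) a = 1) α
    (isClosed_eq (PadicInt.mahlerSeries (fun i => ((1 : A) - 1) ^ i)).continuous continuous_const) (fun k => ?_)
  rw [oneUnitPow_natCast norm_one_sub_one_lt_one, one_pow]

omit [CompleteSpace A] [IsUltrametricDist A] in
/-- `α ↦ u^α` is continuous on `ℤ_p` (a Mahler series). [cite: Gouvea1993PadicNumbers, §5.9] -/
theorem continuous_oneUnitPow (u : A) : Continuous fun α : ℤ_[p] => PadicInt.mahlerSeries (fun i => (u - 1) ^ i) α :=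
  (PadicInt.mahlerSeries (fun i => (u - 1) ^ i)).continuous

/-! ## §2. The laws -/

/-- **`u^{α + β} = u^α u^β`** (both sides continuous in `(α, β)`, equal on `ℕ × ℕ`). [cite: Gouvea1993PadicNumbers, §5.9] -/
theorem oneUnitPow_add (hu : ‖u - 1‖ < 1) (α β : ℤ_[p]) :
    PadicInt.mahlerSeries (fun i => (u - 1) ^ i) (α + β) =
      PadicInt.mahlerSeries (fun i => (u - 1) ^ i) α * PadicInt.mahlerSeries (fun i => (u - 1) ^ i) β := by
  have hc := continuous_oneUnitPow (p := p) u
  refine PadicInt.denseRange_natCast.induction_on₂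
    (p := fun a b => PadicInt.mahlerSeries (fun i => (u - 1) ^ i) (a + b) =
      PadicInt.mahlerSeries (fun i => (u - 1) ^ i) a * PadicInt.mahlerSeries (fun i => (u - 1) ^ i) b)
    (isClosed_eq (hc.comp (continuous_fst.add continuous_snd)) ((hc.comp continuous_fst).mul (hc.comp continuous_snd)))
    (fun a b => ?_) α β
  rw [← Nat.cast_add, oneUnitPow_natCast hu, oneUnitPow_natCast hu, oneUnitPow_natCast hu, pow_add]

/-- `u^{-α} u^α = 1`. [cite: Gouvea1993PadicNumbers, §5.9] -/
theorem oneUnitPow_neg_mul (hu : ‖u - 1‖ < 1) (α : ℤ_[p]) :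
    PadicInt.mahlerSeries (fun i => (u - 1) ^ i) (-α) * PadicInt.mahlerSeries (fun i => (u - 1) ^ i) α = 1 := by
  rw [← oneUnitPow_add hu, neg_add_cancel, oneUnitPow_zero hu]

/-- `u^α` is a unit of `A`. [cite: Gouvea1993PadicNumbers, §5.9] -/
theorem isUnit_oneUnitPow (hu : ‖u - 1‖ < 1) (α : ℤ_[p]) : IsUnit (PadicInt.mahlerSeries (fun i => (u - 1) ^ i) α) :=
  isUnit_iff_exists_inv.mpr ⟨PadicInt.mahlerSeries (fun i => (u - 1) ^ i) (-α), by rw [mul_comm]; exact oneUnitPow_neg_mul hu α⟩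

omit [IsUltrametricDist A] in
/-- `u` itself is a unit (`‖u − 1‖ < 1`; geometric series). [cite: Gouvea1993PadicNumbers, §5.9] -/
theorem isUnit_of_norm_sub_one_lt_one (hu : ‖u - 1‖ < 1) : IsUnit u := by
  have h := (Units.oneSub (1 - u) (by rwa [norm_sub_rev])).isUnit
  rwa [Units.val_oneSub, sub_sub_cancel] at h

/-- For an integer `α = k`: `u^k` is the `k`-th power of the unit `u`. [cite: Gouvea1993PadicNumbers, §5.9] -/
theorem oneUnitPow_intCast (hu : ‖u - 1‖ < 1) (k : ℤ) :
    PadicInt.mahlerSeries (fun i => (u - 1) ^ i) (k : ℤ_[p]) = (((isUnit_of_norm_sub_one_lt_one hu).unit ^ k : Aˣ) : A) := by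
  have h1 : (((isUnit_of_norm_sub_one_lt_one hu).unit : Aˣ) : A) = u := IsUnit.unit_spec _
  obtain ⟨n, rfl | rfl⟩ := Int.eq_nat_or_neg k
  · rw [Int.cast_natCast, oneUnitPow_natCast hu, zpow_natCast, Units.val_pow_eq_pow_val, h1]
  · have hn : PadicInt.mahlerSeries (fun i => (u - 1) ^ i) ((n : ℤ) : ℤ_[p]) =
        (((isUnit_of_norm_sub_one_lt_one hu).unit ^ (n : ℤ) : Aˣ) : A) := by
      rw [Int.cast_natCast, oneUnitPow_natCast hu, zpow_natCast, Units.val_pow_eq_pow_val, h1]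
    have hmul := oneUnitPow_neg_mul hu ((n : ℤ) : ℤ_[p])
    rw [hn, ← Int.cast_neg, mul_comm] at hmul
    rw [zpow_neg]
    exact Units.eq_inv_of_mul_eq_one_left hmul

/-- The ℕ-power of a binomial power: `(u^α)^k = u^{kα}`. [cite: Gouvea1993PadicNumbers, §5.9] -/
theorem oneUnitPow_pow (hu : ‖u - 1‖ < 1) (α : ℤ_[p]) (k : ℕ) :
    PadicInt.mahlerSeries (fun i => (u - 1) ^ i) α ^ k = PadicInt.mahlerSeries (fun i => (u - 1) ^ i) ((k : ℤ_[p]) * α) := by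
  induction k with
  | zero => rw [pow_zero, Nat.cast_zero, zero_mul, oneUnitPow_zero hu]
  | succ k ih => rw [pow_succ, ih, Nat.cast_succ, add_mul, one_mul, oneUnitPow_add hu]

omit [CompleteSpace A] in
/-- The product of two one-units is a one-unit: `‖uv − 1‖ < 1`. [cite: Gouvea1993PadicNumbers, §5.9] [cite: Serre1973, Ch. II §3.2] -/
theorem norm_mul_sub_one_lt_one (hu : ‖u - 1‖ < 1) (hv : ‖v - 1‖ < 1) : ‖u * v - 1‖ < 1 := by
  have e : u * v - 1 = (u - 1) + (v - 1) + (u - 1) * (v - 1) := by ring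
  rw [e]
  refine (IsUltrametricDist.norm_add_le_max _ _).trans_lt (max_lt ((IsUltrametricDist.norm_add_le_max _ _).trans_lt (max_lt hu hv)) ?_)
  exact (norm_mul_le _ _).trans_lt (by nlinarith [norm_nonneg (u - 1), norm_nonneg (v - 1)])

/-- ★ **`u^α v^α = (uv)^α`**. [cite: Gouvea1993PadicNumbers, §5.9] -/
theorem oneUnitPow_mul_base (hu : ‖u - 1‖ < 1) (hv : ‖v - 1‖ < 1) (α : ℤ_[p]) :
    PadicInt.mahlerSeries (fun i => (u - 1) ^ i) α * PadicInt.mahlerSeries (fun i => (v - 1) ^ i) α =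
      PadicInt.mahlerSeries (fun i => (u * v - 1) ^ i) α := by
  refine PadicInt.denseRange_natCast.induction_on
    (p := fun a => PadicInt.mahlerSeries (fun i => (u - 1) ^ i) a * PadicInt.mahlerSeries (fun i => (v - 1) ^ i) a =
      PadicInt.mahlerSeries (fun i => (u * v - 1) ^ i) a) α
    (isClosed_eq ((continuous_oneUnitPow (p := p) u).mul (continuous_oneUnitPow (p := p) v)) (continuous_oneUnitPow (p := p) _))
    (fun k => ?_)
  rw [oneUnitPow_natCast hu, oneUnitPow_natCast hv, oneUnitPow_natCast (norm_mul_sub_one_lt_one hu hv), mul_pow]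

/-! ## §3. One-units are preserved (`‖1‖ = 1`) -/

variable [NormOneClass A]

omit [CompleteSpace A] [Module ℤ_[p] A] [IsBoundedSMul ℤ_[p] A] in
/-- `‖uᵏ‖ ≤ 1` for a one-unit `u`. [cite: Gouvea1993PadicNumbers, §5.9] [cite: Serre1973, Ch. II §3.2] -/
theorem norm_pow_le_one_of_norm_sub_one_lt_one (hu : ‖u - 1‖ < 1) (k : ℕ) : ‖u ^ k‖ ≤ 1 := by
  have h1 : ‖u‖ ≤ 1 := by
    calc ‖u‖ = ‖(u - 1) + 1‖ := by rw [sub_add_cancel]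
      _ ≤ max ‖u - 1‖ ‖(1 : A)‖ := IsUltrametricDist.norm_add_le_max _ _
      _ ≤ 1 := max_le hu.le (by rw [norm_one])
  induction k with
  | zero => rw [pow_zero, norm_one]
  | succ k ih => rw [pow_succ]; exact (norm_mul_le _ _).trans (mul_le_one₀ ih (norm_nonneg _) h1)

/-- **`u^α` is a one-unit: `‖u^α − 1‖ ≤ ‖u − 1‖`** (for `α = k ∈ ℕ`, `uᵏ − 1 = (u − 1) · Σ_{i<k} uⁱ`; then density).
[cite: Gouvea1993PadicNumbers, §5.9] -/
theorem norm_oneUnitPow_sub_one_le (hu : ‖u - 1‖ < 1) (α : ℤ_[p]) :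
    ‖PadicInt.mahlerSeries (fun i => (u - 1) ^ i) α - 1‖ ≤ ‖u - 1‖ := by
  have hc := continuous_oneUnitPow (p := p) u
  refine PadicInt.denseRange_natCast.induction_on
    (p := fun a => ‖PadicInt.mahlerSeries (fun i => (u - 1) ^ i) a - 1‖ ≤ ‖u - 1‖) α
    (isClosed_le ((hc.sub continuous_const).norm) continuous_const) (fun k => ?_)
  rw [oneUnitPow_natCast hu, ← geom_sum_mul u k]
  refine (norm_mul_le _ _).trans (mul_le_of_le_one_left (norm_nonneg _) ?_)
  exact IsUltrametricDist.norm_sum_le_of_forall_le_of_nonneg zero_le_one fun i _ => norm_pow_le_one_of_norm_sub_one_lt_one hu i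

/-- `‖u^α‖ ≤ 1`. [cite: Gouvea1993PadicNumbers, §5.9] -/
theorem norm_oneUnitPow_le_one (hu : ‖u - 1‖ < 1) (α : ℤ_[p]) : ‖PadicInt.mahlerSeries (fun i => (u - 1) ^ i) α‖ ≤ 1 := by
  have h := norm_oneUnitPow_sub_one_le hu α
  calc ‖PadicInt.mahlerSeries (fun i => (u - 1) ^ i) α‖
      = ‖(PadicInt.mahlerSeries (fun i => (u - 1) ^ i) α - 1) + 1‖ := by rw [sub_add_cancel]
    _ ≤ max ‖PadicInt.mahlerSeries (fun i => (u - 1) ^ i) α - 1‖ ‖(1 : A)‖ := IsUltrametricDist.norm_add_le_max _ _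
    _ ≤ 1 := max_le (h.trans hu.le) (by rw [norm_one])

/-- ★ **`(u^α)^β = u^{αβ}`** — iterated powers (the base `u^α` is a one-unit by `norm_oneUnitPow_sub_one_le`; both sides are continuous in
`β` and agree for `β = k ∈ ℕ` by `oneUnitPow_pow`). [cite: Gouvea1993PadicNumbers, §5.9] -/
theorem oneUnitPow_mul_exp (hu : ‖u - 1‖ < 1) (α β : ℤ_[p]) :
    PadicInt.mahlerSeries (fun j => (PadicInt.mahlerSeries (fun i => (u - 1) ^ i) α - 1) ^ j) β =
      PadicInt.mahlerSeries (fun i => (u - 1) ^ i) (α * β) := by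
  have hu' : ‖PadicInt.mahlerSeries (fun i => (u - 1) ^ i) α - 1‖ < 1 := (norm_oneUnitPow_sub_one_le hu α).trans_lt hu
  refine PadicInt.denseRange_natCast.induction_on
    (p := fun b => PadicInt.mahlerSeries (fun j => (PadicInt.mahlerSeries (fun i => (u - 1) ^ i) α - 1) ^ j) b =
      PadicInt.mahlerSeries (fun i => (u - 1) ^ i) (α * b)) β
    (isClosed_eq (continuous_oneUnitPow (p := p) _) ((continuous_oneUnitPow (p := p) u).comp (continuous_const.mul continuous_id)))
    (fun k => ?_)
  rw [oneUnitPow_natCast hu', oneUnitPow_pow hu, mul_comm]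

end Binomial

end Literature.NumberTheory.LocalFields.UltrametricAlgebra

end
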